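import Summits.QuantumFields.YangMills.Theorems.BalabanUVNodesK0AllTorusOfStepTokensGuardedZB

/-!
# K0⁷ V22-Z — THE TWO REGISTERED STUB TEXTS AS TREE DEFINITIONS, THE LOCATED K0–N09 INTERFACE LETTER `2·a₀ ≤ ε₀·L²` AT THE Z3 MEMBER (director-ym №288 (2)(c) «LOCATED-K0ε₀»,
# displayed ONCE BY NAME as a K0-numerics hypothesis on stub 3ᴬ′'s output), THE STRENGTHENED 3ᴬ′-G‴-Z TEXT CARRYING IT, and the kernel doors

Cell `ym-nodeO-ideate`, DEFINER seat `ym-nodeO-def-1` (gen 28; author of Z1 ∕ Z2 ∕ Z3, A2ʷ-ZB p706279, the Z socket p708729, the Z3 K0 body L3 p709671 and the V22-Z candidate the plan adopted).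
`--kind definition --supports stmt-QuantumFields-20541 --as helper`; count-neutral.  The V22-Z twin of k0-s3-w2's `…K0V20GDefs` (same purpose, same shape): plan g92 REGISTERED
**V22-Z** on K0⁷ stmt-QuantumFields-20541 (`[YMPLAN-G92-K0V22Z-REGISTERED fe2ecbb43f63b100]`, pub-ymgap bus 2026-08-29 10:21Z, director-ym №281 «GO V22-Z»; file
`HOME/pub-ymgap-plan/D92-K0V22Z/K0Skeleton13SepCoPHV22Z.lean`, ns `…Theses.BalabanUVNodes.K0Skeleton13SepCoPHV22Z`): ACTIVE stubs `stub_prop8StepCoPGridG13 : ∀ F, Prop8StepCoPGridGAt F`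
and `stub_absBetaBoxAtThm1WitnessCCMGenGridGZ13 : ∀ F, AbsBetaBoxAtThm1WitnessCCMGenGridGZAt F`; the two predicates are `def`s LOCAL to the skeleton (never imported), so no tree file can
spell them.  §1 puts the two registered texts into the tree BYTE-FOR-BYTE (skeleton :73–78 and :84–96).  §2 types director-ym №288 (2)(c): dag-n24-c g17's LOCATED-N09NUM (bus
13:03Z) found that the N09 junction at the Z3 member `εbg := a₀` needs, besides rows curable inside the N24 engine, the row `2·a₀ ≤ ε₀·L²` where `ε₀` is stub 3ᴬ′'s OWN ∃-output
(the β-box window ∕ small-field threshold `ν.ε₀` of DEF-1's family) — «nobody's theorem as typed; in print ε₀ = ε₀(d, L), so it holds there»; the director RULED it a LOCATED binder,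
displayed once BY NAME as a K0-numerics hypothesis on stub 3's output, never discharged by `le_rfl`-style pins, its FORM (per-door display vs door guard) the plan's ∕ DEF-1's call.
THIS FILE gives both forms their ONE name: the letter `K0N09Eps0LetterAt F a₀ ε₀` and the strengthened text `AbsBetaBoxAtThm1WitnessCCMGenGridGZEps0At F` (= the registered 3ᴬ′-G‴-Z text
with the letter conjoined to the ∃-output, every other byte identical) — a face DISPLAYS `∀ F, …GZEps0At F` once by name (today's form, V22-Z untouched), a future re-text would REGISTER it
(one more substitution; the plan's word); §3's doors make either consumable: strengthened ⟹ registered text, the letter read off the strengthened output, and K0⁷'s body from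
stub 1-G‴ + the stub-2′ text + the strengthened text over L3 §5, route-independent (so a by-name proof of the stronger text also lands on the registered road).
[15] = [Balaban1985Variational]; [6] = [Balaban1985RegularSpaces]; [III] = [Balaban1988Convergent]; [I] = [Balaban1987RG1]; [II] = [Balaban1989LargeFieldII].

HONEST FRAMING.  Texts and kernel doors only; nothing of Bałaban asserted; the letter is a DISPLAYED HYPOTHESIS, discharged nowhere (and by design never by a numerics pin); no value of
`a₀` ∕ `ε₀` chosen for anybody; K0⁷ V22-Z fe2ecbb43f63b100 «0∕2 (+2′)» OF RECORD, its texts untouched, NOTHING registered here; FLAG №7 (N09) NOT closed — this names one of its located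
rows; K1⁹ 27364 ∕ K3⁸ 27366 OPEN; counts unmoved (typed 28∕28 · discharged 8∕28); R4 = the conditional finite-𝕋⁴ rung `BalabanLadder.UV` only — NOT continuum ∕ ℝ⁴ ∕ OS; the Yang–Mills mass gap
(Clay) is NOT proved by any of this.  No `sorry`, no `instance`, no `notation`.
-/

noncomputable section

open MeasureTheory
open scoped Matrix.Norms.L2Operator

namespace Summit.QuantumFields.YangMills.Theorems.K0V22ZDefs

open Literature.MathematicalPhysics.QuantumFieldTheory.Balaban1983to89
open Literature.MathematicalPhysics.QuantumFieldTheory.Balaban1983to89.Node00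
open Literature.MathematicalPhysics.QuantumFieldTheory.Balaban1983to89.T4Continuum
open Literature.MathematicalPhysics.QuantumFieldTheory.Balaban1983to89.FlowStep
open Literature.MathematicalPhysics.QuantumFieldTheory.Balaban1983to89.B8LeafModelZd (ZdIdx)
open Summit.QuantumFields.YangMills.Theorems.K0AllTorusOfStepTokensGuardedZB (record13SepCoPHBody_of_stubs1G3_2P_3A'G3ZB)

/-! ## §1. The two REGISTERED V22-Z stub texts, verbatim (skeleton fe2ecbb43f63b100 :73–78 ∕ :84–96) -/

/-- **V22-Z stub 1-G‴ text** (= V21-G's, byte-identical; [15] Prop. 8's top step at NODE 00's support domains under the four-conjunct grid guard `A‴(c, c₀, c₁)`, `c c₀ c₁` ∃-bound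
OUTERMOST).  Tree copy of the registered `K0Skeleton13SepCoPHV22Z.Prop8StepCoPGridGAt`. [cite: Balaban1985Variational, Prop. 8 p.304, p.304 lines 1–2; Balaban1985RegularSpaces, (1.3)–(1.6) p.77; Balaban1988Convergent, (2.1) p.254, (2.5) p.255, (2.17)–(2.18) p.257; Balaban1987RG1, (0.1) p.251] -/
def Prop8StepCoPGridGAt (F : T4Family) : Prop :=
  ∃ (c c₀ c₁ : ℕ) (B₃ a₀ a₁ : ℝ), 2 * (F.L : ℝ) ^ 2 ≤ B₃ ∧ 0 < a₀ ∧ 0 < a₁ ∧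
    Prop8RegSepTopStepG F 2 (fun ν K Ω => suppDomOfRecord F ν K Ω)
      (fun ν M g K k _s => c ≤ ν.M₁ ∧ k + c₀ ≤ F.m + K ∧ F.L ^ c₁ ∣ M ∧
        ∀ i, 1 ≤ i → i ≤ k → dCubeSide (F.P K).L M (RkOfRecord (F.P K).L ν.r (g i)) i ∣ (F.P K).sitesPerDir 0) B₃ a₀ a₁

/-- **V22-Z stub 3ᴬ′-G‴-Z text**: the sign-free |β| box at the LETTER-FREE PRINT-REGIME MEMBER of DEF-1's Z3 family `theta13OfThm1CCMWZB F 2 j (1 / 2) a₀ ε₀ ε₂₉ B₃ B₃' a₀ a₁ (fun _ _ => 0) (fun _ _ => 0)`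
(`εbg := a₀` = the text's own ∀-bound `a₀`) from the grid-guarded (8)-sentence and (9)-token.  Tree copy of the registered `K0Skeleton13SepCoPHV22Z.AbsBetaBoxAtThm1WitnessCCMGenGridGZAt`.
[cite: Balaban1985Variational, Thm 1 (8),(9) p.279; Balaban1988Convergent, (2.1) p.254, (2.5) p.255, p.257; Balaban1987RG1, (1.12) p.262, (0.21) p.256, (1.6) p.261, (1.20)–(1.22) p.264] -/
def AbsBetaBoxAtThm1WitnessCCMGenGridGZAt (F : T4Family) : Prop :=
  ∀ (j c c₀ c₁ : ℕ) (B₃ B₃' a₀ a₁ : ℝ), c ≤ F.L ^ j → c₀ ≤ j + 1 → c₁ ≤ j → 2 * (F.L : ℝ) ^ 2 ≤ B₃ → 0 < B₃' → 0 < a₀ → 0 < a₁ →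
    VariationalThm1RegSepCoP7MG F 2
      (fun ν M g K k _s => c ≤ ν.M₁ ∧ k + c₀ ≤ F.m + K ∧ F.L ^ c₁ ∣ M ∧
        ∀ i, 1 ≤ i → i ≤ k → dCubeSide (F.P K).L M (RkOfRecord (F.P K).L ν.r (g i)) i ∣ (F.P K).sitesPerDir 0) B₃ a₀ a₁ →
    Gauge9RegSepTopStepG F 2 (fun ν K Ω => suppDomOfRecord F ν K Ω) (F.L ^ j)
      (fun ν M g K k _s => c ≤ ν.M₁ ∧ k + c₀ ≤ F.m + K ∧ F.L ^ c₁ ∣ M ∧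
        ∀ i, 1 ≤ i → i ≤ k → dCubeSide (F.P K).L M (RkOfRecord (F.P K).L ν.r (g i)) i ∣ (F.P K).sitesPerDir 0) B₃ B₃' a₀ a₁ →
    ∃ γ₀ ε₀ ε₂₉ β' : ℝ, 0 < γ₀ ∧ 0 < ε₀ ∧ 0 < ε₂₉ ∧
      BetaLowerH (-β') γ₀ (betaOfRecord₁₃ F 2 (theta13OfThm1CCMWZB F 2 j (1 / 2) a₀ ε₀ ε₂₉ B₃ B₃' a₀ a₁ (fun _ _ => 0) (fun _ _ => 0))) ∧
      BetaUpperH β' γ₀ (betaOfRecord₁₃ F 2 (theta13OfThm1CCMWZB F 2 j (1 / 2) a₀ ε₀ ε₂₉ B₃ B₃' a₀ a₁ (fun _ _ => 0) (fun _ _ => 0)))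

/-! ## §2. ★ LOCATED-K0ε₀ (director-ym №288 (2)(c)): the K0–N09 interface letter at the Z3 member and the strengthened 3ᴬ′-G‴-Z text that carries it on stub 3's OWN output -/

/-- **★ THE K0–N09 INTERFACE LETTER AT THE Z3 MEMBER, BY NAME** (dag-n24-c g17 LOCATED-N09NUM row 3; director-ym №288 (2)(c) «LOCATED-K0ε₀»): `2·a₀ ≤ ε₀·L²` — the door v1.2
nesting row `2·εbg ≤ ν.ε₀·L²` of N09's roads read at `εbg := a₀`, `ν.ε₀ := ε₀` (the Z3 member's letters, Z3 faces `theta13OfThm1CCMWZB_εbg ∕ _ε₀`).  A DISPLAYED HYPOTHESIS on stub 3ᴬ′'s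
∃-output `ε₀`; in print `ε₀` depends on `(d, L)` only ([I] Thm 1), so the row holds there as `a₀ ↓ 0`; as typed it is nobody's theorem and is NEVER to be discharged by a numerics pin.
[cite: Balaban1987RG1, Thm 1 p.259, (0.21) p.256, (1.2) p.260; Balaban1985Variational, Thm 1 (8) p.279] -/
def K0N09Eps0LetterAt (F : T4Family) (a₀ ε₀ : ℝ) : Prop :=
  2 * a₀ ≤ ε₀ * (F.L : ℝ) ^ 2

/-- **★ THE STRENGTHENED 3ᴬ′-G‴-Z TEXT «WITH LOCATED-K0ε₀»**: the registered V22-Z text with the interface letter `K0N09Eps0LetterAt F a₀ ε₀` CONJOINED TO THE ∃-OUTPUT (after the three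
signs), every other byte identical — the ONE name under which a face displays the letter «once, on stub 3's output» (today's form; V22-Z untouched), and which a future re-text of stub 3
would register by one more substitution (the plan's word).  NOT registered; NOT asserted. [cite: Balaban1985Variational, Thm 1 (8),(9) p.279; Balaban1987RG1, Thm 1 p.259, (1.2) p.260, (1.20)–(1.22) p.264; Balaban1988Convergent, (2.1) p.254, (2.5) p.255] -/
def AbsBetaBoxAtThm1WitnessCCMGenGridGZEps0At (F : T4Family) : Prop :=
  ∀ (j c c₀ c₁ : ℕ) (B₃ B₃' a₀ a₁ : ℝ), c ≤ F.L ^ j → c₀ ≤ j + 1 → c₁ ≤ j → 2 * (F.L : ℝ) ^ 2 ≤ B₃ → 0 < B₃' → 0 < a₀ → 0 < a₁ →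
    VariationalThm1RegSepCoP7MG F 2
      (fun ν M g K k _s => c ≤ ν.M₁ ∧ k + c₀ ≤ F.m + K ∧ F.L ^ c₁ ∣ M ∧
        ∀ i, 1 ≤ i → i ≤ k → dCubeSide (F.P K).L M (RkOfRecord (F.P K).L ν.r (g i)) i ∣ (F.P K).sitesPerDir 0) B₃ a₀ a₁ →
    Gauge9RegSepTopStepG F 2 (fun ν K Ω => suppDomOfRecord F ν K Ω) (F.L ^ j)
      (fun ν M g K k _s => c ≤ ν.M₁ ∧ k + c₀ ≤ F.m + K ∧ F.L ^ c₁ ∣ M ∧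
        ∀ i, 1 ≤ i → i ≤ k → dCubeSide (F.P K).L M (RkOfRecord (F.P K).L ν.r (g i)) i ∣ (F.P K).sitesPerDir 0) B₃ B₃' a₀ a₁ →
    ∃ γ₀ ε₀ ε₂₉ β' : ℝ, 0 < γ₀ ∧ 0 < ε₀ ∧ 0 < ε₂₉ ∧ K0N09Eps0LetterAt F a₀ ε₀ ∧
      BetaLowerH (-β') γ₀ (betaOfRecord₁₃ F 2 (theta13OfThm1CCMWZB F 2 j (1 / 2) a₀ ε₀ ε₂₉ B₃ B₃' a₀ a₁ (fun _ _ => 0) (fun _ _ => 0))) ∧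
      BetaUpperH β' γ₀ (betaOfRecord₁₃ F 2 (theta13OfThm1CCMWZB F 2 j (1 / 2) a₀ ε₀ ε₂₉ B₃ B₃' a₀ a₁ (fun _ _ => 0) (fun _ _ => 0)))

/-! ## §3. Kernel doors (displayed, count-neutral) -/

/-- The strengthened text implies the REGISTERED text at `F` (drop the letter). [cite: Balaban1987RG1, §1 p.264 (bookkeeping)] -/
theorem absBetaBoxGenGridGZAt_of_eps0 (F : T4Family) (h : AbsBetaBoxAtThm1WitnessCCMGenGridGZEps0At F) : AbsBetaBoxAtThm1WitnessCCMGenGridGZAt F :=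
  fun j c c₀ c₁ B₃ B₃' a₀ a₁ hc hc₀ hc₁ hB₃ hB₃' ha₀ ha₁ h15 h9 => by
    obtain ⟨γ₀, ε₀, ε₂₉, β', hγ₀, hε₀, hε₂₉, -, hlow, hup⟩ := h j c c₀ c₁ B₃ B₃' a₀ a₁ hc hc₀ hc₁ hB₃ hB₃' ha₀ ha₁ h15 h9
    exact ⟨γ₀, ε₀, ε₂₉, β', hγ₀, hε₀, hε₂₉, hlow, hup⟩

/-- The letter READ OFF the strengthened output at a door (the form the N24 engine consumes at its chosen `(j, c, c₀, c₁; B₃, B₃', a₀, a₁)`): some `ε₀ > 0` with `2·a₀ ≤ ε₀·L²` AND the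
β-box at the Z3 member for the same `ε₀`. [cite: Balaban1987RG1, Thm 1 p.259, (1.2) p.260 (bookkeeping)] -/
theorem exists_eps0Letter_absBox_of_eps0 (F : T4Family) (h : AbsBetaBoxAtThm1WitnessCCMGenGridGZEps0At F) (j c c₀ c₁ : ℕ) (B₃ B₃' a₀ a₁ : ℝ)
    (hc : c ≤ F.L ^ j) (hc₀ : c₀ ≤ j + 1) (hc₁ : c₁ ≤ j) (hB₃ : 2 * (F.L : ℝ) ^ 2 ≤ B₃) (hB₃' : 0 < B₃') (ha₀ : 0 < a₀) (ha₁ : 0 < a₁)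
    (h15 : VariationalThm1RegSepCoP7MG F 2
      (fun ν M g K k _s => c ≤ ν.M₁ ∧ k + c₀ ≤ F.m + K ∧ F.L ^ c₁ ∣ M ∧
        ∀ i, 1 ≤ i → i ≤ k → dCubeSide (F.P K).L M (RkOfRecord (F.P K).L ν.r (g i)) i ∣ (F.P K).sitesPerDir 0) B₃ a₀ a₁)
    (h9 : Gauge9RegSepTopStepG F 2 (fun ν K Ω => suppDomOfRecord F ν K Ω) (F.L ^ j)
      (fun ν M g K k _s => c ≤ ν.M₁ ∧ k + c₀ ≤ F.m + K ∧ F.L ^ c₁ ∣ M ∧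
        ∀ i, 1 ≤ i → i ≤ k → dCubeSide (F.P K).L M (RkOfRecord (F.P K).L ν.r (g i)) i ∣ (F.P K).sitesPerDir 0) B₃ B₃' a₀ a₁) :
    ∃ γ₀ ε₀ ε₂₉ β' : ℝ, 0 < γ₀ ∧ 0 < ε₀ ∧ 0 < ε₂₉ ∧ 2 * a₀ ≤ ε₀ * (F.L : ℝ) ^ 2 ∧
      BetaLowerH (-β') γ₀ (betaOfRecord₁₃ F 2 (theta13OfThm1CCMWZB F 2 j (1 / 2) a₀ ε₀ ε₂₉ B₃ B₃' a₀ a₁ (fun _ _ => 0) (fun _ _ => 0))) ∧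
      BetaUpperH β' γ₀ (betaOfRecord₁₃ F 2 (theta13OfThm1CCMWZB F 2 j (1 / 2) a₀ ε₀ ε₂₉ B₃ B₃' a₀ a₁ (fun _ _ => 0) (fun _ _ => 0))) :=
  h j c c₀ c₁ B₃ B₃' a₀ a₁ hc hc₀ hc₁ hB₃ hB₃' ha₀ ha₁ h15 h9

/-- **K0⁷'s BODY AT EVERY FAMILY from the REGISTERED stub 1-G‴ text, the stub-2′ text and the STRENGTHENED 3ᴬ′ text** (L3 §5 through §3's first door; route-independent form —
the landed stub 2′ `K0V19Stub2Prime.stub_prop6MemberB8AtP13` fills `h2P` at the caller): a by-name proof of the stronger text composes K0⁷'s body exactly as the registered one does.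
CONDITIONAL; K0⁷ NOT closed here; nothing of Bałaban asserted. [cite: Balaban1985Variational, Thm 1 (8)–(9) p.279, Prop. 8 p.304; Balaban1985RegularSpaces, Prop. 6 p.99; Balaban1988Convergent, Thm 1 p.262, (2.1) p.254; Balaban1987RG1, Thm 1 p.259, (0.1) p.251] -/
theorem k0Body_of_stub1_of_2P_of_eps0 (h1 : ∀ F : T4Family, Prop8StepCoPGridGAt F)
    (h2P : ∀ F : T4Family, ∃ (ρ₀ : ℕ) (B₁ c₁ : ℝ), 1 ≤ ρ₀ ∧ 0 ≤ B₁ ∧ 0 < c₁ ∧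
      (letI : CStarAlgebra (MatA 2) := {}; B8.Prop6Printed 4 (F.L : ℝ) B₁ c₁ (fun i : ZdIdx 4 F.L => zdCubP (MatA 2) F.L ρ₀ i)))
    (h3e : ∀ F : T4Family, AbsBetaBoxAtThm1WitnessCCMGenGridGZEps0At F) :
    ∀ F : T4Family, ∃ θ : Stage13HParams F 2, θ.Provisos₁₃SepCoPH F 2 ∧ (θ.ZhUnity F 2 ∧ θ.SlotsNondegenerate₁₃ F 2) ∧ θ.Admissible F 2 :=
  record13SepCoPHBody_of_stubs1G3_2P_3A'G3ZB h1 h2P fun F => absBetaBoxGenGridGZAt_of_eps0 F (h3e F)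

end Summit.QuantumFields.YangMills.Theorems.K0V22ZDefs

end
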